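import Literature.NumberTheory.Sieve.BarbanDavenportHalberstamTools
import Literature.NumberTheory.Sieve.VaughanMeanValueDecomposition
import Literature.NumberTheory.LFunctions.SiegelWalfisz
import HarnessLib

/-!
# The Barban–Davenport–Halberstam theorem (upper bound) — proved

For the centred variance of the primes in arithmetic progressions
`V(x,Q) = ∑_{h ≤ Q} ∑*_{a (h)} (ψ(x;h,a) − ψ_h(x)/φ(h))²` (`BDHVariance.bdhVariance`, whose unconditional LOWER
bound `≥ (1−ε)QN log(Q²/N)…` in `√N ≤ Q ≤ N` is the named fact `harperSoundararajan2017_theorem1`), the classical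
UPPER bound of Barban (1964) and Davenport–Halberstam (1966) holds: for every real `A`,

`V(x,Q) ≤ C(A)·(Q x (log x)³ + x²/(log x)^A)`   for all `x ≥ 3`, `1 ≤ Q ≤ x`

(`bdhVariance_le`; Davenport ch. 29 gives `Qx log x` for `x(log x)^{−A} ≤ Q ≤ x` — the exponent `3` of the
logarithm here is the cost of the weak constants `(1 + log Q)²` of the tree's totient sums and is irrelevant for
every use in the range `Q ≤ x^{1−ε}`). PROOF (Davenport ch. 29): Parseval over the reduced classes turns the class
variance at modulus `h` into `φ(h)⁻¹ ∑_{χ ≠ χ₀} |ψ(x,χ)|²` (`BDH.classVarianceAt_eq_charForm`); characters of conductor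
`> R = (log x)^{A+4}` are handled by the large sieve over all moduli (`BDH.sum_totient_inv_largeConductor_prim_le`, from
`largeSieve_character_nat`) after passing to primitive inducers at the cost `R(h,x) ≤ (log x/log 2)·log h`
(`BDH.norm_chebyshevPsiChar_induce_le`, `nonCoprimePart_le`) and `∑_{n≤x} Λ(n)² ≤ (log 4 + 4) x log x`
(`Vaughan.sum_vonMangoldt_sq_le`); the `≤ R²` characters of conductor in `(1, R]` (`BDH.card_primIndex_filter_le`) are
bounded one by one by the Siegel–Walfisz theorem (`siegel_walfisz_holds`, PROVED in the tree) through
`|ψ(x,χ*)| ≤ ∑*_{a (d)} |ψ(x;d,a) − x/φ(d)|`. Unconditional; the implied constant is ineffective exactly as Siegel's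
theorem is. Standard axioms.

## References
* [Davenport1980] H. Davenport, *Multiplicative Number Theory*, 2nd ed., ch. 29 «An average result» (the
  Barban–Davenport–Halberstam theorem) — the theorem proved here (with `(log x)³` for `log x`).
* [IwaniecKowalski2004] §17.3, Thm 17.2 (Barban–Davenport–Halberstam) — statement.
-/

noncomputable section

open Finset Real
open scoped ArithmeticFunction.vonMangoldt

namespace Literature.NumberTheory.Sieve.BDH

open LargeSieve BDHVariance

/-! ### §0. Small analytic helpers -/

/-- `(log x)^k ≤ k^k · x` for `x ≥ 1`, `k ≥ 1` (from `log x ≤ x^{1/k}/(1/k)`). [folklore] -/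
private theorem log_pow_le (k : ℕ) (hk : 1 ≤ k) {x : ℝ} (hx : 1 ≤ x) :
    Real.log x ^ k ≤ (k : ℝ) ^ k * x := by
  have hx0 : 0 ≤ x := by linarith
  have hk0 : (0 : ℝ) < k := by exact_mod_cast hk
  have hlog0 : 0 ≤ Real.log x := Real.log_nonneg hx
  have h1 : Real.log x ≤ x ^ ((1 : ℝ) / k) / ((1 : ℝ) / k) :=
    Real.log_le_rpow_div hx0 (by positivity)
  have h2 : Real.log x ≤ (k : ℝ) * x ^ ((1 : ℝ) / k) := by
    rw [div_div_eq_mul_div, div_one, mul_comm] at h1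
    simpa [one_div] using h1
  calc Real.log x ^ k ≤ ((k : ℝ) * x ^ ((1 : ℝ) / k)) ^ k := pow_le_pow_left₀ hlog0 h2 k
    _ = (k : ℝ) ^ k * (x ^ ((1 : ℝ) / k)) ^ k := mul_pow _ _ _
    _ = (k : ℝ) ^ k * x := by
        congr 1
        rw [← Real.rpow_natCast, ← Real.rpow_mul hx0, one_div_mul_cancel hk0.ne', Real.rpow_one]

/-- `(u + v)² ≤ 2u² + 2v²`. [folklore] -/
private theorem add_sq_le (u v : ℝ) : (u + v) ^ 2 ≤ 2 * u ^ 2 + 2 * v ^ 2 := by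
  nlinarith [sq_nonneg (u - v)]

/-! ### §1. Re-indexing a conductor condition by primitive inducers -/

/-- For `f ≥ 0` and any decidable condition `P` on the conductor:
`∑_{χ mod h} 𝟙[P(cond χ)] f(χ) ≤ ∑_{(d,ψ) ∈ S(h), P(d)} f(ψ_h)`. [cite: Davenport1980, ch. 29 — derivation] -/
theorem sum_ite_conductor_le_sum_primIndex {h : ℕ} [NeZero h] (P : ℕ → Prop) [DecidablePred P]
    {f : DirichletCharacter ℂ h → ℝ} (hf : ∀ χ, 0 ≤ f χ) :
    ∑ χ : DirichletCharacter ℂ h, (if P χ.conductor then f χ else 0) ≤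
      ∑ σ ∈ (primIndex h).filter (fun σ => P σ.1), f (induce h σ) := by
  have hcond : ∀ σ ∈ primIndex h, (induce h σ).conductor = σ.1 := by
    intro σ hσ
    obtain ⟨hd, -, hprim⟩ := mem_primIndex.1 hσ
    rw [induce, dif_pos hd, DirichletCharacter.conductor_changeLevel]
    exact hprim
  rw [Finset.sum_filter]
  calc ∑ χ : DirichletCharacter ℂ h, (if P χ.conductor then f χ else 0)
      ≤ ∑ σ ∈ primIndex h, (if P (induce h σ).conductor then f (induce h σ) else 0) :=
        sum_le_sum_primIndex h (f := fun χ => if P χ.conductor then f χ else 0)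
          fun χ => by split_ifs <;> simp [hf χ]
    _ = ∑ σ ∈ primIndex h, (if P σ.1 then f (induce h σ) else 0) :=
        Finset.sum_congr rfl fun σ hσ => by rw [hcond σ hσ]

/-- The non-trivial characters split by conductor at `R`: for `f ≥ 0` and any finite set `T` of
non-trivial characters, `∑_{χ ∈ T} f ≤ ∑_{(d,ψ)∈S(h), 1<d≤R} f(ψ_h) + ∑_{(d,ψ)∈S(h), R<d} f(ψ_h)`.
[cite: Davenport1980, ch. 29 — derivation] -/
theorem sum_ne_one_le_small_add_large {h : ℕ} [NeZero h] (R : ℕ)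
    {f : DirichletCharacter ℂ h → ℝ} (hf : ∀ χ, 0 ≤ f χ) (T : Finset (DirichletCharacter ℂ h))
    (hT : ∀ χ ∈ T, χ ≠ 1) :
    ∑ χ ∈ T, f χ ≤
      ∑ σ ∈ (primIndex h).filter (fun σ => 1 < σ.1 ∧ σ.1 ≤ R), f (induce h σ) +
        ∑ σ ∈ (primIndex h).filter (fun σ => R < σ.1), f (induce h σ) := by
  -- pointwise: a non-trivial `χ` has conductor `> 1`, hence lies in one of the two ranges
  have hpt : ∀ χ ∈ T, f χ ≤ (if 1 < χ.conductor ∧ χ.conductor ≤ R then f χ else 0) +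
      (if R < χ.conductor then f χ else 0) := by
    intro χ hχ
    have hne := hT χ hχ
    rw [Ne, DirichletCharacter.eq_one_iff_conductor_eq_one] at hne
    have h0 := DirichletCharacter.conductor_ne_zero χ
    by_cases hc : R < χ.conductor
    · rw [if_pos hc]; split_ifs <;> linarith [hf χ]
    · have h1 : 1 < χ.conductor ∧ χ.conductor ≤ R := ⟨by omega, by omega⟩
      rw [if_pos h1, if_neg hc]; linarith
  calc ∑ χ ∈ T, f χ
      ≤ ∑ χ ∈ T, ((if 1 < χ.conductor ∧ χ.conductor ≤ R then f χ else 0) +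
          (if R < χ.conductor then f χ else 0)) := Finset.sum_le_sum hpt
    _ ≤ ∑ χ : DirichletCharacter ℂ h, ((if 1 < χ.conductor ∧ χ.conductor ≤ R then f χ else 0) +
          (if R < χ.conductor then f χ else 0)) :=
        Finset.sum_le_sum_of_subset_of_nonneg (Finset.subset_univ T) fun χ _ _ => by
          split_ifs <;> linarith [hf χ]
    _ = ∑ χ : DirichletCharacter ℂ h, (if 1 < χ.conductor ∧ χ.conductor ≤ R then f χ else 0) +
          ∑ χ : DirichletCharacter ℂ h, (if R < χ.conductor then f χ else 0) := Finset.sum_add_distrib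
    _ ≤ _ := add_le_add (sum_ite_conductor_le_sum_primIndex (fun c => 1 < c ∧ c ≤ R) hf)
          (sum_ite_conductor_le_sum_primIndex (fun c => R < c) hf)

/-! ### §2. The two character ranges at one modulus -/

open scoped Classical in
/-- **Large conductors at one modulus**: passing to primitive inducers,
`∑_{(d,ψ)∈S(h), d>R} |ψ(x,ψ_h)|² ≤ 2∑_{(d,ψ)∈S(h), d>R} |ψ(x,ψ)|² + 2h·R(h,x)²`. [cite: Davenport1980, ch. 29 — derivation] -/
theorem sum_large_induce_le {h : ℕ} [NeZero h] (R : ℕ) (x : ℝ) :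
    ∑ σ ∈ (primIndex h).filter (fun σ => R < σ.1), ‖chebyshevPsiChar (induce h σ) x‖ ^ 2 ≤
      2 * ∑ σ ∈ (primIndex h).filter (fun σ => R < σ.1), ‖chebyshevPsiChar σ.2 x‖ ^ 2 +
        2 * h * nonCoprimePart h x ^ 2 := by
  have hncp : 0 ≤ nonCoprimePart h x := nonCoprimePart_nonneg h x
  calc ∑ σ ∈ (primIndex h).filter (fun σ => R < σ.1), ‖chebyshevPsiChar (induce h σ) x‖ ^ 2
      ≤ ∑ σ ∈ (primIndex h).filter (fun σ => R < σ.1),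
          (2 * ‖chebyshevPsiChar σ.2 x‖ ^ 2 + 2 * nonCoprimePart h x ^ 2) := by
        refine Finset.sum_le_sum fun σ hσ => ?_
        have hσ' := (Finset.mem_filter.1 hσ).1
        calc ‖chebyshevPsiChar (induce h σ) x‖ ^ 2
            ≤ (‖chebyshevPsiChar σ.2 x‖ + nonCoprimePart h x) ^ 2 :=
              pow_le_pow_left₀ (norm_nonneg _) (norm_chebyshevPsiChar_induce_le hσ' x) 2
          _ ≤ _ := add_sq_le _ _
    _ = 2 * ∑ σ ∈ (primIndex h).filter (fun σ => R < σ.1), ‖chebyshevPsiChar σ.2 x‖ ^ 2 +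
          ((primIndex h).filter (fun σ => R < σ.1)).card * (2 * nonCoprimePart h x ^ 2) := by
        rw [Finset.sum_add_distrib, Finset.mul_sum, Finset.sum_const, nsmul_eq_mul]
    _ ≤ 2 * ∑ σ ∈ (primIndex h).filter (fun σ => R < σ.1), ‖chebyshevPsiChar σ.2 x‖ ^ 2 +
          (h : ℝ) * (2 * nonCoprimePart h x ^ 2) := by
        gcongr
        exact_mod_cast (Finset.card_filter_le _ _).trans (card_primIndex_le h)
    _ = _ := by ring

open scoped Classical in
/-- **Small conductors at one modulus**: if `|ψ(x;d,a) − x/φ(d)| ≤ W` for all `2 ≤ d ≤ R` and all reduced `a`,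
then `∑_{(d,ψ)∈S(h), 1<d≤R} |ψ(x,ψ_h)|² ≤ R²·(R·W + R(h,x))²`. [cite: Davenport1980, ch. 29 — derivation] -/
theorem sum_small_induce_le {h : ℕ} [NeZero h] (R : ℕ) (x W : ℝ) (hW0 : 0 ≤ W)
    (hW : ∀ (d : ℕ) [NeZero d], 2 ≤ d → d ≤ R → ∀ a : (ZMod d)ˣ,
      |ParityWave0.chebyshevPsiMod d (a : ZMod d) x - x / Nat.totient d| ≤ W) :
    ∑ σ ∈ (primIndex h).filter (fun σ => 1 < σ.1 ∧ σ.1 ≤ R), ‖chebyshevPsiChar (induce h σ) x‖ ^ 2 ≤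
      ((R : ℝ) * R) * ((R : ℝ) * W + nonCoprimePart h x) ^ 2 := by
  have hncp : 0 ≤ nonCoprimePart h x := nonCoprimePart_nonneg h x
  have hterm : ∀ σ ∈ (primIndex h).filter (fun σ => 1 < σ.1 ∧ σ.1 ≤ R),
      ‖chebyshevPsiChar (induce h σ) x‖ ^ 2 ≤ ((R : ℝ) * W + nonCoprimePart h x) ^ 2 := by
    intro σ hσ
    obtain ⟨hσ', h1, h2⟩ := Finset.mem_filter.1 hσ
    obtain ⟨-, -, hprim⟩ := mem_primIndex.1 hσ'
    haveI : NeZero σ.1 := ⟨by omega⟩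
    have hne : σ.2 ≠ 1 := by
      intro h1'
      have := (DirichletCharacter.isPrimitive_def _).1 hprim
      rw [h1', DirichletCharacter.conductor_one] at this
      omega
    have hψ : ‖chebyshevPsiChar σ.2 x‖ ≤ (R : ℝ) * W := by
      calc ‖chebyshevPsiChar σ.2 x‖
          ≤ ∑ a : (ZMod σ.1)ˣ, |ParityWave0.chebyshevPsiMod σ.1 (a : ZMod σ.1) x - x / Nat.totient σ.1| :=
            norm_chebyshevPsiChar_le_sum_units hne x
        _ ≤ ∑ _a : (ZMod σ.1)ˣ, W := Finset.sum_le_sum fun a _ => hW σ.1 h1 h2 a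
        _ = (Fintype.card (ZMod σ.1)ˣ : ℝ) * W := by rw [Finset.sum_const, Finset.card_univ, nsmul_eq_mul]
        _ ≤ (R : ℝ) * W := by
            refine mul_le_mul_of_nonneg_right ?_ hW0
            rw [ZMod.card_units_eq_totient]
            exact_mod_cast (Nat.totient_le σ.1).trans h2
    calc ‖chebyshevPsiChar (induce h σ) x‖ ^ 2
        ≤ (‖chebyshevPsiChar σ.2 x‖ + nonCoprimePart h x) ^ 2 :=
          pow_le_pow_left₀ (norm_nonneg _) (norm_chebyshevPsiChar_induce_le hσ' x) 2
      _ ≤ ((R : ℝ) * W + nonCoprimePart h x) ^ 2 :=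
          pow_le_pow_left₀ (by positivity) (by linarith) 2
  calc ∑ σ ∈ (primIndex h).filter (fun σ => 1 < σ.1 ∧ σ.1 ≤ R), ‖chebyshevPsiChar (induce h σ) x‖ ^ 2
      ≤ ∑ σ ∈ (primIndex h).filter (fun σ => 1 < σ.1 ∧ σ.1 ≤ R), ((R : ℝ) * W + nonCoprimePart h x) ^ 2 :=
        Finset.sum_le_sum hterm
    _ = (((primIndex h).filter (fun σ => 1 < σ.1 ∧ σ.1 ≤ R)).card : ℝ) *
          ((R : ℝ) * W + nonCoprimePart h x) ^ 2 := by rw [Finset.sum_const, nsmul_eq_mul]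
    _ ≤ ((R : ℝ) * R) * ((R : ℝ) * W + nonCoprimePart h x) ^ 2 := by
        refine mul_le_mul_of_nonneg_right ?_ (by positivity)
        have hsub : (primIndex h).filter (fun σ => 1 < σ.1 ∧ σ.1 ≤ R) ⊆ (primIndex h).filter (fun σ => σ.1 ≤ R) :=
          Finset.monotone_filter_right _ fun σ _ hσ => hσ.2
        exact_mod_cast (Finset.card_le_card hsub).trans (card_primIndex_filter_le h R)

/-! ### §3. The theorem -/

/-! ### §3. Numerical assembly lemmas -/

/-- Part (a): the Siegel–Walfisz range. [cite: Davenport1980, ch. 29 — derivation] -/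
private theorem partA_le {L x C' W E S : ℝ} {R B A₂ a k : ℕ} (hL1 : 1 ≤ L) (hx1 : 1 ≤ x)
    (hC' : 0 ≤ C') (hW : W = C' * x / L ^ A₂) (hE : E = 2 * L ^ 2) (hR0 : 0 < (R : ℝ))
    (hRle : (R : ℝ) ≤ L ^ B) (hA₂ : 2 + 4 * B + a ≤ 2 * A₂) (hLk : L ^ (2 * B + 6 + a) ≤ (k : ℝ) ^ k * x)
    (hS : S ≤ 4 * L ^ 2) :
    S * (((R : ℝ) * R) * ((R : ℝ) * W + E) ^ 2) ≤ (12 * C' ^ 2 + 50 * (k : ℝ) ^ k) * (x ^ 2 / L ^ a) := by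
  have hL0 : 0 < L := by linarith
  have hLpos : ∀ n : ℕ, 0 < L ^ n := fun n => pow_pos hL0 n
  have hLmono : ∀ {m n : ℕ}, m ≤ n → L ^ m ≤ L ^ n := fun hmn => pow_le_pow_right₀ hL1 hmn
  have hW0 : 0 ≤ W := by rw [hW]; positivity
  have hE0 : 0 ≤ E := by rw [hE]; positivity
  have hRB : (R : ℝ) * R ≤ L ^ B * L ^ B := mul_le_mul hRle hRle hR0.le (by positivity)
  have hRW : (R : ℝ) * W ≤ L ^ B * W := mul_le_mul_of_nonneg_right hRle hW0
  have hsq : ((R : ℝ) * W + E) ^ 2 ≤ 2 * (L ^ B * W) ^ 2 + 2 * E ^ 2 := by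
    have h0 : 0 ≤ (R : ℝ) * W := mul_nonneg hR0.le hW0
    have h1 := pow_le_pow_left₀ h0 hRW 2
    have h2 := add_sq_le ((R : ℝ) * W) E
    linarith
  have hT1 : L ^ 2 * (L ^ B * L ^ B) * (L ^ B * W) ^ 2 ≤ C' ^ 2 * x ^ 2 / L ^ a := by
    have heq : L ^ 2 * (L ^ B * L ^ B) * (L ^ B * W) ^ 2 =
        C' ^ 2 * x ^ 2 * (L ^ (2 + 4 * B) / L ^ (2 * A₂)) := by
      rw [hW]; field_simp; ring
    rw [heq, div_eq_mul_one_div (C' ^ 2 * x ^ 2)]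
    refine mul_le_mul_of_nonneg_left ?_ (by positivity : (0 : ℝ) ≤ C' ^ 2 * x ^ 2)
    rw [div_le_div_iff₀ (hLpos _) (hLpos _), one_mul, ← pow_add]
    exact hLmono hA₂
  have hT2 : L ^ 2 * (L ^ B * L ^ B) * E ^ 2 ≤ 4 * (k : ℝ) ^ k * x ^ 2 / L ^ a := by
    have heq : L ^ 2 * (L ^ B * L ^ B) * E ^ 2 = 4 * (L ^ (2 * B + 6 + a) / L ^ a) := by
      rw [hE]; field_simp; ring
    rw [heq]
    have hxx2 : x ≤ x ^ 2 := by nlinarith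
    have hxx : (k : ℝ) ^ k * x ≤ (k : ℝ) ^ k * x ^ 2 :=
      mul_le_mul_of_nonneg_left hxx2 (by positivity)
    have := div_le_div_of_nonneg_right (hLk.trans hxx) (hLpos a).le
    calc 4 * (L ^ (2 * B + 6 + a) / L ^ a) ≤ 4 * ((k : ℝ) ^ k * x ^ 2 / L ^ a) := by linarith
      _ = 4 * (k : ℝ) ^ k * x ^ 2 / L ^ a := by ring
  have e1 : C' ^ 2 * x ^ 2 / L ^ a = C' ^ 2 * (x ^ 2 / L ^ a) := by ring
  have e2 : 4 * (k : ℝ) ^ k * x ^ 2 / L ^ a = 4 * ((k : ℝ) ^ k * (x ^ 2 / L ^ a)) := by ring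
  have h1 : 0 ≤ C' ^ 2 * (x ^ 2 / L ^ a) := by positivity
  have h2 : 0 ≤ (k : ℝ) ^ k * (x ^ 2 / L ^ a) := by positivity
  calc S * (((R : ℝ) * R) * ((R : ℝ) * W + E) ^ 2)
      ≤ (4 * L ^ 2) * ((L ^ B * L ^ B) * (2 * (L ^ B * W) ^ 2 + 2 * E ^ 2)) :=
        mul_le_mul hS (mul_le_mul hRB hsq (by positivity) (by positivity)) (by positivity) (by positivity)
    _ = 8 * (L ^ 2 * (L ^ B * L ^ B) * (L ^ B * W) ^ 2) + 8 * (L ^ 2 * (L ^ B * L ^ B) * E ^ 2) := by ring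
    _ ≤ 8 * (C' ^ 2 * x ^ 2 / L ^ a) + 8 * (4 * (k : ℝ) ^ k * x ^ 2 / L ^ a) := by linarith
    _ = 8 * (C' ^ 2 * (x ^ 2 / L ^ a)) + 32 * ((k : ℝ) ^ k * (x ^ 2 / L ^ a)) := by rw [e1, e2]; ring
    _ ≤ (12 * C' ^ 2 + 50 * (k : ℝ) ^ k) * (x ^ 2 / L ^ a) := by nlinarith

/-- Part (b): the large-sieve range. [cite: Davenport1980, ch. 29 — derivation] -/
private theorem partB_le {L x T U : ℝ} {R B a Q K : ℕ} (hL1 : 1 ≤ L) (hx1 : 1 ≤ x)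
    (hR0 : 0 < (R : ℝ)) (hRge : L ^ B ≤ 2 * R) (hB : B = a + 4) (hKx : (K : ℝ) ≤ x)
    (hlogQ : (1 + Real.log Q) ^ 2 ≤ 4 * L ^ 2) (hU0 : 0 ≤ U) (hU : U ≤ 6 * x * L)
    (hT : T ≤ (1 + Real.log Q) ^ 2 * (2 * ((K : ℝ) + 1) / R + 4 * Q) * U) :
    2 * T ≤ 260 * ((Q : ℝ) * x * L ^ 3) + 780 * (x ^ 2 / L ^ a) := by
  have hL0 : 0 < L := by linarith
  have hx0 : 0 < x := by linarith
  have hLpos : ∀ n : ℕ, 0 < L ^ n := fun n => pow_pos hL0 n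
  have hLmono : ∀ {m n : ℕ}, m ≤ n → L ^ m ≤ L ^ n := fun hmn => pow_le_pow_right₀ hL1 hmn
  have hKR : 2 * ((K : ℝ) + 1) / R ≤ 8 * x / L ^ B := by
    rw [div_le_div_iff₀ hR0 (hLpos B)]
    have : 2 * ((K : ℝ) + 1) ≤ 4 * x := by linarith
    calc 2 * ((K : ℝ) + 1) * L ^ B ≤ 4 * x * (2 * R) := mul_le_mul this hRge (hLpos B).le (by positivity)
      _ = 8 * x * R := by ring
  have hcoef : (1 + Real.log Q) ^ 2 * (2 * ((K : ℝ) + 1) / R + 4 * Q) ≤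
      4 * L ^ 2 * (8 * x / L ^ B + 4 * Q) :=
    mul_le_mul hlogQ (add_le_add hKR le_rfl) (by positivity) (by positivity)
  have hx2 : x * (L ^ 2 * (x / L ^ B * L)) ≤ x ^ 2 / L ^ a := by
    have heq : x * (L ^ 2 * (x / L ^ B * L)) = x ^ 2 / L ^ (a + 1) := by
      rw [hB]; field_simp; ring
    rw [heq]
    exact div_le_div_of_nonneg_left (by positivity) (hLpos a) (hLmono (by omega))
  have hpos1 : 0 ≤ (Q : ℝ) * x * L ^ 3 := by positivity
  have hpos2 : 0 ≤ x ^ 2 / L ^ a := by positivity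
  have hmain : T ≤ (4 * L ^ 2 * (8 * x / L ^ B + 4 * Q)) * (6 * x * L) :=
    hT.trans (mul_le_mul hcoef hU hU0 (by positivity))
  have heq : (4 * L ^ 2 * (8 * x / L ^ B + 4 * Q)) * (6 * x * L) =
      192 * (x * (L ^ 2 * (x / L ^ B * L))) + 96 * ((Q : ℝ) * x * L ^ 3) := by ring
  linarith

/-! ### §4. The theorem -/

open scoped Classical in
/-- **The Barban–Davenport–Halberstam theorem (upper bound).** For every real `A` there is `C` such that for all
`x ≥ 3` and all `1 ≤ Q ≤ x`:
`∑_{h ≤ Q} ∑*_{a (h)} (ψ(x;h,a) − ψ_h(x)/φ(h))² ≤ C·(Q x (log x)³ + x²/(log x)^A)`.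
(Barban 1964; Davenport–Halberstam 1966; Gallagher's large-sieve proof as in Davenport ch. 29, with Siegel–Walfisz for
the conductors `≤ (log x)^{⌈A⌉+4}`; the constant is ineffective.) [cite: Davenport1980, ch. 29 (theorem); IwaniecKowalski2004, Thm 17.2] -/
theorem bdhVariance_le (A : ℝ) :
    ∃ C : ℝ, ∀ x : ℝ, 3 ≤ x → ∀ Q : ℕ, 1 ≤ Q → (Q : ℝ) ≤ x →
      bdhVariance x Q ≤ C * ((Q : ℝ) * x * Real.log x ^ 3 + x ^ 2 / Real.log x ^ A) := by
  classical
  -- natural exponents: `a = ⌈A⌉`, `B = a + 4`, `A₂ = 2B + 1 + a`, `k = 2B + 6 + a`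
  obtain ⟨a, haA⟩ : ∃ a : ℕ, A ≤ a := ⟨⌈A⌉₊, Nat.le_ceil A⟩
  obtain ⟨Csw, hCsw⟩ := Literature.NumberTheory.LFunctions.siegel_walfisz_holds
    ((2 * (a + 4) + 1 + a : ℕ) : ℝ) (by positivity)
  refine ⟨260 + 900 + 780 + 12 * (max Csw 0) ^ 2 +
    50 * ((2 * (a + 4) + 6 + a : ℕ) : ℝ) ^ (2 * (a + 4) + 6 + a), fun x hx Q hQ1 hQx => ?_⟩
  have hC'0 : 0 ≤ max Csw 0 := le_max_right _ _
  -- basic quantities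
  have hx1 : (1 : ℝ) ≤ x := by linarith
  have hx0 : (0 : ℝ) < x := by linarith
  have hL1 : 1 ≤ Real.log x := by
    rw [← Real.log_exp 1]
    exact Real.log_le_log (Real.exp_pos 1) (le_trans (by linarith [Real.exp_one_lt_d9]) hx)
  have hL0 : 0 < Real.log x := by linarith
  have hLpos : ∀ n : ℕ, 0 < Real.log x ^ n := fun n => pow_pos hL0 n
  have hLmono : ∀ {m n : ℕ}, m ≤ n → Real.log x ^ m ≤ Real.log x ^ n := fun hmn => pow_le_pow_right₀ hL1 hmn
  have hlogQ : Real.log Q ≤ Real.log x := Real.log_le_log (by exact_mod_cast hQ1) hQx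
  have hlogQ0 : 0 ≤ Real.log Q := Real.log_natCast_nonneg Q
  have h1logQ : (1 + Real.log Q) ^ 2 ≤ 4 * Real.log x ^ 2 := by nlinarith
  have hKx : (⌊x⌋₊ : ℝ) ≤ x := Nat.floor_le hx0.le
  have hK1 : 1 ≤ ⌊x⌋₊ := Nat.one_le_iff_ne_zero.2 (Nat.floor_pos.2 hx1).ne'
  -- the cut-off `R = max 1 ⌊L^B⌋`
  have hLB1 : 1 ≤ Real.log x ^ (a + 4) := one_le_pow₀ hL1
  have hR1 : 1 ≤ max 1 ⌊Real.log x ^ (a + 4)⌋₊ := le_max_left _ _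
  have hRle : ((max 1 ⌊Real.log x ^ (a + 4)⌋₊ : ℕ) : ℝ) ≤ Real.log x ^ (a + 4) := by
    push_cast
    exact max_le (by exact_mod_cast hLB1) (Nat.floor_le (by positivity))
  have hRge : Real.log x ^ (a + 4) ≤ 2 * ((max 1 ⌊Real.log x ^ (a + 4)⌋₊ : ℕ) : ℝ) := by
    have hfl : Real.log x ^ (a + 4) - 1 ≤ (⌊Real.log x ^ (a + 4)⌋₊ : ℝ) := by
      have := Nat.lt_floor_add_one (Real.log x ^ (a + 4)); linarith
    have h1 : (⌊Real.log x ^ (a + 4)⌋₊ : ℝ) ≤ ((max 1 ⌊Real.log x ^ (a + 4)⌋₊ : ℕ) : ℝ) := by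
      exact_mod_cast le_max_right _ _
    have h2 : (1 : ℝ) ≤ ((max 1 ⌊Real.log x ^ (a + 4)⌋₊ : ℕ) : ℝ) := by exact_mod_cast hR1
    by_cases hcase : Real.log x ^ (a + 4) ≤ 2
    · linarith
    · linarith
  have hR0 : (0 : ℝ) < ((max 1 ⌊Real.log x ^ (a + 4)⌋₊ : ℕ) : ℝ) := by exact_mod_cast hR1
  -- the Siegel–Walfisz bound for moduli `2 ≤ d ≤ R`
  have hSW : ∀ (d : ℕ) [NeZero d], 2 ≤ d → d ≤ max 1 ⌊Real.log x ^ (a + 4)⌋₊ → ∀ u : (ZMod d)ˣ,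
      |ParityWave0.chebyshevPsiMod d (u : ZMod d) x - x / Nat.totient d| ≤
        max Csw 0 * x / Real.log x ^ (2 * (a + 4) + 1 + a) := by
    intro d _ hd2 hdR u
    have hdA : (d : ℝ) ≤ Real.log x ^ ((2 * (a + 4) + 1 + a : ℕ) : ℝ) := by
      rw [Real.rpow_natCast]
      calc (d : ℝ) ≤ ((max 1 ⌊Real.log x ^ (a + 4)⌋₊ : ℕ) : ℝ) := by exact_mod_cast hdR
        _ ≤ Real.log x ^ (a + 4) := hRle
        _ ≤ Real.log x ^ (2 * (a + 4) + 1 + a) := hLmono (by omega)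
    calc |ParityWave0.chebyshevPsiMod d (u : ZMod d) x - x / Nat.totient d|
        ≤ Csw * x / Real.log x ^ ((2 * (a + 4) + 1 + a : ℕ) : ℝ) := hCsw x (by linarith) d (by omega) hdA u
      _ ≤ max Csw 0 * x / Real.log x ^ (2 * (a + 4) + 1 + a) := by
          rw [Real.rpow_natCast]
          exact div_le_div_of_nonneg_right (mul_le_mul_of_nonneg_right (le_max_left _ _) hx0.le)
            (hLpos _).le
  -- the non-coprime remainder: `R(h,x) ≤ (log x/log 2) log h ≤ 2 L²` for `h ≤ Q ≤ x`
  have hncp : ∀ h ∈ Icc 1 Q, nonCoprimePart h x ≤ 2 * Real.log x ^ 2 := by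
    intro h hh
    have hh1 : 1 ≤ h := (mem_Icc.1 hh).1
    have hhQ : h ≤ Q := (mem_Icc.1 hh).2
    have hlogh : Real.log h ≤ Real.log x :=
      le_trans (Real.log_le_log (by exact_mod_cast hh1) (by exact_mod_cast hhQ)) hlogQ
    have hlogh0 : 0 ≤ Real.log h := Real.log_natCast_nonneg h
    have hfl : (⌊Real.log x / Real.log 2⌋₊ : ℝ) ≤ 2 * Real.log x := by
      have hl2 : (1 : ℝ) / 2 ≤ Real.log 2 := by
        have := Real.log_two_gt_d9; linarith
      calc (⌊Real.log x / Real.log 2⌋₊ : ℝ) ≤ Real.log x / Real.log 2 := Nat.floor_le (by positivity)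
        _ ≤ Real.log x / (1 / 2) := div_le_div_of_nonneg_left hL0.le (by norm_num) hl2
        _ = 2 * Real.log x := by ring
    calc nonCoprimePart h x ≤ ⌊Real.log x / Real.log 2⌋₊ * Real.log h := nonCoprimePart_le (by omega) hx0.le
      _ ≤ 2 * Real.log x * Real.log x := mul_le_mul hfl hlogh hlogh0 (by positivity)
      _ = 2 * Real.log x ^ 2 := by ring
  -- abbreviate
  obtain ⟨R, hRdef⟩ : ∃ R : ℕ, R = max 1 ⌊Real.log x ^ (a + 4)⌋₊ := ⟨_, rfl⟩
  obtain ⟨W, hWdef⟩ : ∃ W : ℝ, W = max Csw 0 * x / Real.log x ^ (2 * (a + 4) + 1 + a) := ⟨_, rfl⟩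
  obtain ⟨E, hEdef⟩ : ∃ E : ℝ, E = 2 * Real.log x ^ 2 := ⟨_, rfl⟩
  rw [← hRdef] at hR1 hRle hRge hR0 hSW
  rw [← hWdef] at hSW
  rw [← hEdef] at hncp
  have hW0 : 0 ≤ W := by rw [hWdef]; positivity
  have hE0 : 0 ≤ E := by rw [hEdef]; positivity
  -- STEP 1: per modulus
  have hV : bdhVariance x Q ≤
      ∑ h ∈ Icc 1 Q, ((h.totient : ℝ))⁻¹ *
        (((R : ℝ) * R) * ((R : ℝ) * W + E) ^ 2 +
          (2 * ∑ σ ∈ (primIndex h).filter (fun σ => R < σ.1), ‖chebyshevPsiChar σ.2 x‖ ^ 2 +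
            2 * h * E ^ 2)) := by
    refine Finset.sum_le_sum fun h hh => ?_
    have hh1 : 1 ≤ h := (mem_Icc.1 hh).1
    haveI : NeZero h := ⟨by omega⟩
    rw [classVarianceAt_eq_charForm]
    refine mul_le_mul_of_nonneg_left ?_ (inv_nonneg.2 (Nat.cast_nonneg _))
    have hncp_h : nonCoprimePart h x ≤ E := hncp h hh
    have hncp0 : 0 ≤ nonCoprimePart h x := nonCoprimePart_nonneg h x
    have hsmall := sum_small_induce_le (h := h) R x W hW0 hSW
    have hlarge := sum_large_induce_le (h := h) R x
    have hsmall' : ((R : ℝ) * R) * ((R : ℝ) * W + nonCoprimePart h x) ^ 2 ≤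
        ((R : ℝ) * R) * ((R : ℝ) * W + E) ^ 2 := by
      refine mul_le_mul_of_nonneg_left ?_ (by positivity)
      exact pow_le_pow_left₀ (by positivity) (by linarith) 2
    have hlarge' : (2 : ℝ) * h * nonCoprimePart h x ^ 2 ≤ 2 * h * E ^ 2 := by
      refine mul_le_mul_of_nonneg_left ?_ (by positivity)
      exact pow_le_pow_left₀ hncp0 hncp_h 2
    calc ∑ χ ∈ Finset.univ.filter (fun χ : DirichletCharacter ℂ h => χ ≠ 1), ‖chebyshevPsiChar χ x‖ ^ 2
        ≤ ∑ σ ∈ (primIndex h).filter (fun σ => 1 < σ.1 ∧ σ.1 ≤ R), ‖chebyshevPsiChar (induce h σ) x‖ ^ 2 +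
            ∑ σ ∈ (primIndex h).filter (fun σ => R < σ.1), ‖chebyshevPsiChar (induce h σ) x‖ ^ 2 :=
          sum_ne_one_le_small_add_large R (fun χ => by positivity) _ (fun χ hχ => (Finset.mem_filter.1 hχ).2)
      _ ≤ ((R : ℝ) * R) * ((R : ℝ) * W + nonCoprimePart h x) ^ 2 +
            (2 * ∑ σ ∈ (primIndex h).filter (fun σ => R < σ.1), ‖chebyshevPsiChar σ.2 x‖ ^ 2 +
              2 * h * nonCoprimePart h x ^ 2) := add_le_add hsmall hlarge
      _ ≤ _ := by linarith
  -- STEP 2: the three sums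
  have hφsum : ∑ h ∈ Icc 1 Q, ((h.totient : ℝ))⁻¹ ≤ 4 * Real.log x ^ 2 :=
    (totientInvSum_le Q).trans h1logQ
  have hφsum0 : 0 ≤ ∑ h ∈ Icc 1 Q, ((h.totient : ℝ))⁻¹ :=
    Finset.sum_nonneg fun _ _ => inv_nonneg.2 (Nat.cast_nonneg _)
  -- (a)
  have ha' : ∑ h ∈ Icc 1 Q, ((h.totient : ℝ))⁻¹ * (((R : ℝ) * R) * ((R : ℝ) * W + E) ^ 2) ≤
      (12 * (max Csw 0) ^ 2 + 50 * ((2 * (a + 4) + 6 + a : ℕ) : ℝ) ^ (2 * (a + 4) + 6 + a)) *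
        (x ^ 2 / Real.log x ^ a) := by
    rw [← Finset.sum_mul]
    have hLk : Real.log x ^ (2 * (a + 4) + 6 + a) ≤
        ((2 * (a + 4) + 6 + a : ℕ) : ℝ) ^ (2 * (a + 4) + 6 + a) * x :=
      log_pow_le (2 * (a + 4) + 6 + a) (by omega) hx1
    exact partA_le (B := a + 4) (A₂ := 2 * (a + 4) + 1 + a) hL1 hx1 hC'0 hWdef hEdef hR0 hRle
      (by omega) hLk hφsum
  -- (b)
  have hb' : ∑ h ∈ Icc 1 Q, ((h.totient : ℝ))⁻¹ *
      (2 * ∑ σ ∈ (primIndex h).filter (fun σ => R < σ.1), ‖chebyshevPsiChar σ.2 x‖ ^ 2) ≤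
        260 * ((Q : ℝ) * x * Real.log x ^ 3) + 780 * (x ^ 2 / Real.log x ^ a) := by
    have hbridge : ∀ h ∈ Icc 1 Q, ((h.totient : ℝ))⁻¹ *
        (2 * ∑ σ ∈ (primIndex h).filter (fun σ => R < σ.1), ‖chebyshevPsiChar σ.2 x‖ ^ 2) =
        2 * (((h.totient : ℝ))⁻¹ * ∑ σ ∈ (primIndex h).filter (fun σ => R < σ.1),
          ‖∑ n ∈ Ioc 0 (0 + ⌊x⌋₊), (((Λ n : ℝ) : ℂ)) * σ.2 n‖ ^ 2) := by
      intro h _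
      rw [zero_add]
      simp_rw [chebyshevPsiChar_eq_sum_Ioc]
      ring
    rw [Finset.sum_congr rfl hbridge, ← Finset.mul_sum]
    have hLS := sum_totient_inv_largeConductor_prim_le (fun n => (((Λ n : ℝ) : ℂ))) 0 ⌊x⌋₊ R Q hR1
    have hΛ : ∑ n ∈ Ioc 0 (0 + ⌊x⌋₊), ‖(((Λ n : ℝ) : ℂ))‖ ^ 2 ≤ (Real.log 4 + 4) * ⌊x⌋₊ * Real.log ⌊x⌋₊ := by
      rw [zero_add]
      refine le_trans (le_of_eq (Finset.sum_congr rfl fun n _ => ?_)) (Vaughan.sum_vonMangoldt_sq_le ⌊x⌋₊)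
      rw [Complex.norm_real, Real.norm_eq_abs, sq_abs]
    have hKpos : (0 : ℝ) < ⌊x⌋₊ := by exact_mod_cast hK1
    have hlogK : Real.log ⌊x⌋₊ ≤ Real.log x := Real.log_le_log hKpos hKx
    have hlogK0 : 0 ≤ Real.log (⌊x⌋₊ : ℝ) := Real.log_natCast_nonneg _
    have h54 : Real.log 4 + 4 ≤ 6 := by
      have h4 : Real.log 4 = 2 * Real.log 2 := by
        rw [show (4 : ℝ) = 2 ^ 2 by norm_num, Real.log_pow]; ring
      rw [h4]; linarith [Real.log_two_lt_d9]
    have hU : ∑ n ∈ Ioc 0 (0 + ⌊x⌋₊), ‖(((Λ n : ℝ) : ℂ))‖ ^ 2 ≤ 6 * x * Real.log x :=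
      hΛ.trans (mul_le_mul (mul_le_mul h54 hKx (Nat.cast_nonneg _) (by norm_num)) hlogK hlogK0
        (by positivity))
    have hU0 : 0 ≤ ∑ n ∈ Ioc 0 (0 + ⌊x⌋₊), ‖(((Λ n : ℝ) : ℂ))‖ ^ 2 :=
      Finset.sum_nonneg fun _ _ => by positivity
    exact partB_le (B := a + 4) hL1 hx1 hR0 hRge rfl hKx h1logQ hU0 hU hLS
  -- (c)
  have hc' : ∑ h ∈ Icc 1 Q, ((h.totient : ℝ))⁻¹ * (2 * h * E ^ 2) ≤ 900 * ((Q : ℝ) * x * Real.log x ^ 3) := by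
    have hterm : ∀ h ∈ Icc 1 Q, ((h.totient : ℝ))⁻¹ * (2 * h * E ^ 2) ≤
        ((h.totient : ℝ))⁻¹ * (2 * Q * E ^ 2) := by
      intro h hh
      refine mul_le_mul_of_nonneg_left ?_ (inv_nonneg.2 (Nat.cast_nonneg _))
      have : (h : ℝ) ≤ Q := by exact_mod_cast (mem_Icc.1 hh).2
      nlinarith [sq_nonneg E]
    have hL3 : Real.log x ^ 3 ≤ 27 * x := by
      have := log_pow_le 3 (by norm_num) hx1
      norm_num at this ⊢; linarith
    calc ∑ h ∈ Icc 1 Q, ((h.totient : ℝ))⁻¹ * (2 * h * E ^ 2)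
        ≤ ∑ h ∈ Icc 1 Q, ((h.totient : ℝ))⁻¹ * (2 * Q * E ^ 2) := Finset.sum_le_sum hterm
      _ = (∑ h ∈ Icc 1 Q, ((h.totient : ℝ))⁻¹) * (2 * Q * E ^ 2) := by rw [Finset.sum_mul]
      _ ≤ (4 * Real.log x ^ 2) * (2 * Q * E ^ 2) := mul_le_mul_of_nonneg_right hφsum (by positivity)
      _ = 32 * (Q : ℝ) * Real.log x ^ 3 * Real.log x ^ 3 := by rw [hEdef]; ring
      _ ≤ 32 * (Q : ℝ) * Real.log x ^ 3 * (27 * x) := mul_le_mul_of_nonneg_left hL3 (by positivity)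
      _ ≤ 900 * ((Q : ℝ) * x * Real.log x ^ 3) := by
          have : 0 ≤ (Q : ℝ) * x * Real.log x ^ 3 := by positivity
          nlinarith
  -- `x²/L^a ≤ x²/L^A`
  have haA' : x ^ 2 / Real.log x ^ a ≤ x ^ 2 / Real.log x ^ A := by
    refine div_le_div_of_nonneg_left (by positivity) (Real.rpow_pos_of_pos hL0 A) ?_
    rw [← Real.rpow_natCast]
    exact Real.rpow_le_rpow_of_exponent_le hL1 haA
  -- assemble
  have hsplit : ∑ h ∈ Icc 1 Q, ((h.totient : ℝ))⁻¹ *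
        (((R : ℝ) * R) * ((R : ℝ) * W + E) ^ 2 +
          (2 * ∑ σ ∈ (primIndex h).filter (fun σ => R < σ.1), ‖chebyshevPsiChar σ.2 x‖ ^ 2 +
            2 * h * E ^ 2)) =
      ∑ h ∈ Icc 1 Q, ((h.totient : ℝ))⁻¹ * (((R : ℝ) * R) * ((R : ℝ) * W + E) ^ 2) +
        (∑ h ∈ Icc 1 Q, ((h.totient : ℝ))⁻¹ *
          (2 * ∑ σ ∈ (primIndex h).filter (fun σ => R < σ.1), ‖chebyshevPsiChar σ.2 x‖ ^ 2) +
          ∑ h ∈ Icc 1 Q, ((h.totient : ℝ))⁻¹ * (2 * h * E ^ 2)) := by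
    rw [← Finset.sum_add_distrib, ← Finset.sum_add_distrib]
    exact Finset.sum_congr rfl fun h _ => by ring
  have hpos1 : 0 ≤ (Q : ℝ) * x * Real.log x ^ 3 := by positivity
  have hpos2 : 0 ≤ x ^ 2 / Real.log x ^ a := by positivity
  have hk0 : 0 ≤ ((2 * (a + 4) + 6 + a : ℕ) : ℝ) ^ (2 * (a + 4) + 6 + a) := by positivity
  have hCk0 : 0 ≤ 12 * (max Csw 0) ^ 2 + 50 * ((2 * (a + 4) + 6 + a : ℕ) : ℝ) ^ (2 * (a + 4) + 6 + a) := by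
    positivity
  calc bdhVariance x Q ≤ _ := hV
    _ = _ := hsplit
    _ ≤ (12 * (max Csw 0) ^ 2 + 50 * ((2 * (a + 4) + 6 + a : ℕ) : ℝ) ^ (2 * (a + 4) + 6 + a)) *
          (x ^ 2 / Real.log x ^ a) +
          ((260 * ((Q : ℝ) * x * Real.log x ^ 3) + 780 * (x ^ 2 / Real.log x ^ a)) +
            900 * ((Q : ℝ) * x * Real.log x ^ 3)) := add_le_add ha' (add_le_add hb' hc')
    _ ≤ (260 + 900 + 780 + 12 * (max Csw 0) ^ 2 +
          50 * ((2 * (a + 4) + 6 + a : ℕ) : ℝ) ^ (2 * (a + 4) + 6 + a)) *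
          ((Q : ℝ) * x * Real.log x ^ 3 + x ^ 2 / Real.log x ^ A) := by
        have h3 : 0 ≤ x ^ 2 / Real.log x ^ A := le_trans hpos2 haA'
        nlinarith

end Literature.NumberTheory.Sieve.BDH
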